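import Mathlib.Combinatorics.SimpleGraph.Walk.Counting
import Mathlib.Combinatorics.SimpleGraph.Paths
import Mathlib.Combinatorics.SimpleGraph.DeleteEdges
import Summits.CriticalPhenomena.SAWScalingLimit.Theorems.SAWTotalPositivityBoundaryTP2Defs
import Summits.CriticalPhenomena.SAWScalingLimit.Theorems.SAWTotalPositivityBoundaryTP2Kernel
import Summits.CriticalPhenomena.SAWScalingLimit.Theorems.SAWTotalPositivityBoundaryTP2Symmetry
import Summits.CriticalPhenomena.SAWScalingLimit.Theorems.SAWTotalPositivityBoundaryTP2MainNonneg
import Summits.CriticalPhenomena.SAWScalingLimit.Theorems.SAWTotalPositivityBoundaryTP2CutGlue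
import HarnessLib

/-!
# Crux `BoundaryTP2` (stmt-CriticalPhenomena-7115), line `renewal-cauchy-binet`: the cut-pair sign lemma

For the fugacity-`x` self-avoiding path kernel `Z_G = pathKernel G x` and a vertex cut `(A, Aᶜ)` of a
graph `H` separating the sources `p₁, p₄ ∈ A` from the targets `p₂, p₃ ∉ A` of an interlaced quadruple
`p₁ p₂ p₃ p₄` (every self-avoiding path `p₁ → p₃` of `H` meets every self-avoiding path `p₂ → p₄`), and
two cut darts `u → v`, `u' → v'` (`u, u' ∈ A`, `v, v' ∉ A`), put

* `ℓ₁ = Z_A(p₁,u) Z_A(p₄,u')`, `ℓ₂ = Z_A(p₁,u') Z_A(p₄,u)` (kernels of the part `G_A` of `H` inside `A`),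
* `μ₁ = Z_B(v,p₂) Z_B(v',p₃)`, `μ₂ = Z_B(v,p₃) Z_B(v',p₂)` (kernels of the part `G_B` of `H` outside `A`).

**The cut-pair sign lemma** (`cutPairSign_core`, the sign engine of the Cauchy–Binet expansion of the
TP₂ determinant across the cut): `ℓ₁ μ₂ + ℓ₂ μ₁ ≤ ℓ₁ μ₁ + ℓ₂ μ₂`, i.e. `(ℓ₁ - ℓ₂)(μ₁ - μ₂) ≥ 0`, granted
TP₂ for the interlaced pairwise distinct quadruples of `G_A` and of `G_B` and the boundary three-point /
two-point inequalities at the marked vertices carrying a cut dart (the hypotheses `tpA`, `tpB`, `h3A`,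
`h3B`, `h2A`, `h2B`; in the induction of the line they come from the induction hypothesis).

Proof. It suffices to show `ℓ₁ < ℓ₂ → μ₁ ≤ μ₂` (the other implication is the same statement for the
swapped darts, and the conclusion follows by the rearrangement inequality). If `ℓ₁ < ℓ₂`, the side-`A`
hypotheses leave only one possibility (`sideA_paths`): vertex-disjoint self-avoiding paths `P : p₁ → u'`,
`P' : u → p₄` of `G_A` (in the generic case because `Interlaced G_A p₁ u u' p₄` would give `ℓ₂ ≤ ℓ₁` by
`tpA`; in the degenerate cases by the three-point / two-point inequalities, or by cutting at a forced
vertex, `pathKernel_le_mul_of_forall_mem_support`). Symmetrically, `μ₂ < μ₁` would produce vertex-disjoint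
self-avoiding paths `Q : p₂ → v`, `Q' : v' → p₃` of `G_B` (`sideB_le`). But then
`P · u'v' · Q'` and `Q · vu · P'` are vertex-disjoint self-avoiding paths `p₁ → p₃`, `p₂ → p₄` of `H`
(`cutPair_false_of_glue`, file `SAWTotalPositivityBoundaryTP2CutGlue.lean`), contradicting interlacing.
Everything here is proved; Mathlib and the landed toolkit of the line only (`pathKernel_comm`,
`pathKernel_self`, `pathKernel_le_mul_of_forall_mem_support`, `cutPair_false_of_glue`). [folklore]
-/

noncomputable section

namespace Summit.CriticalPhenomena.SAWScalingLimit.Theorems.BoundaryTP2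

open scoped ENNReal

variable {V : Type*}

/-! ## Walk lemmas -/

/-- Adjacency in the part of `H` cut out by a vertex predicate `P`
(`SimpleGraph.fromRel fun a b => H.Adj a b ∧ P a ∧ P b`): `a ∼ b` iff `H.Adj a b ∧ P a ∧ P b`. [folklore] -/
-- adapted from `partGraph_adj` in `SAWTotalPositivityBoundaryTP2OneEdgeCut.lean`
private theorem partGraph_adj_iff (H : SimpleGraph V) (P : V → Prop) {a b : V} :
    (SimpleGraph.fromRel fun a b => H.Adj a b ∧ P a ∧ P b).Adj a b ↔ H.Adj a b ∧ P a ∧ P b := by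
  rw [SimpleGraph.fromRel_adj]
  constructor
  · rintro ⟨-, h | h⟩
    · exact h
    · exact ⟨h.1.symm, h.2.2, h.2.1⟩
  · exact fun h => ⟨h.1.ne, Or.inl h⟩

/-! ## Algebra -/

/-- The rearrangement inequality for two pairs in `ℝ≥0∞`: `a ≤ b`, `c ≤ d` give `a d + b c ≤ a c + b d`
(write `b = a + e`, `d = c + f`; the difference is `e f`). [folklore] -/
private theorem rearrangement {a b c d : ℝ≥0∞} (hab : a ≤ b) (hcd : c ≤ d) :
    a * d + b * c ≤ a * c + b * d := by
  obtain ⟨e, rfl⟩ := exists_add_of_le hab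
  obtain ⟨f, rfl⟩ := exists_add_of_le hcd
  calc a * (c + f) + (a + e) * c ≤ a * (c + f) + (a + e) * c + e * f := le_self_add
    _ = a * c + (a + e) * (c + f) := by ring

/-! ## Side `A`: the sources -/

/-- **Side `A` of the cut.** For darts `u → v`, `u' → v'` leaving `A` (`v, v' ∉ A`) with `u ≠ u'`,
`p₁ ≠ p₄`, and a graph `G_A` (the part of `H` inside `A`) satisfying TP₂ for its interlaced pairwise
distinct quadruples (`tpA`), the three-point inequality `Z(c,p) Z(c,q) ≤ Z(p,q)` at `c ∈ {p₁, p₄}`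
whenever `c` carries a dart of `H` leaving `A` (`h3A`) and `Z(p₁,p₄) ≤ 1` when both do (`h2A`):
if `ℓ₁ = Z(p₁,u) Z(p₄,u') < Z(p₁,u') Z(p₄,u) = ℓ₂` then there are vertex-disjoint self-avoiding paths
`p₁ → u'` and `u → p₄` of `G_A`. Cases: `u = p₁` or `u' = p₄` contradict `ℓ₁ < ℓ₂` (`h3A`, `h2A`,
`Z(a,a) = 1`); `u' = p₁` or `u = p₄`: a trivial path and a path avoiding its vertex (else cutting at
that forced vertex gives `ℓ₂ ≤ ℓ₁`); generic: `¬ Interlaced G_A p₁ u u' p₄` (else `tpA` gives `ℓ₂ ≤ ℓ₁`).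
[folklore] -/
private theorem sideA_paths {H GA : SimpleGraph V} {x : ℝ} (hx : 0 ≤ x) {A : Set V}
    {p₁ p₄ u v u' v' : V} (h14 : p₁ ≠ p₄) (huu' : u ≠ u')
    (huv : H.Adj u v) (hv : v ∉ A) (hu'v' : H.Adj u' v') (hv' : v' ∉ A)
    (tpA : ∀ q₁ q₂ q₃ q₄ : V, q₁ ≠ q₂ → q₁ ≠ q₃ → q₁ ≠ q₄ → q₂ ≠ q₃ → q₂ ≠ q₄ → q₃ ≠ q₄ →
      Interlaced GA q₁ q₂ q₃ q₄ →
        pathKernel GA x q₁ q₃ * pathKernel GA x q₂ q₄ ≤ pathKernel GA x q₁ q₂ * pathKernel GA x q₃ q₄)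
    (h3A : ∀ c p q : V, (c = p₁ ∨ c = p₄) → (∃ w, H.Adj c w ∧ w ∉ A) → c ≠ p → c ≠ q → p ≠ q →
      pathKernel GA x c p * pathKernel GA x c q ≤ pathKernel GA x p q)
    (h2A : (∃ w, H.Adj p₁ w ∧ w ∉ A) → (∃ w, H.Adj p₄ w ∧ w ∉ A) → pathKernel GA x p₁ p₄ ≤ 1)
    (hℓ : pathKernel GA x p₁ u * pathKernel GA x p₄ u' <
      pathKernel GA x p₁ u' * pathKernel GA x p₄ u) :
    ∃ (P : GA.Walk p₁ u') (P' : GA.Walk u p₄),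
      P.IsPath ∧ P'.IsPath ∧ List.Disjoint P.support P'.support := by
  classical
  -- `u = p₁`: `ℓ₁ = Z(p₄,u')`, `ℓ₂ = Z(p₁,u') Z(p₁,p₄)`, and `ℓ₂ ≤ ℓ₁` by `h3A` / `h2A`
  by_cases h1u : p₁ = u
  · subst h1u
    exfalso
    rw [pathKernel_self, one_mul, pathKernel_comm GA x p₄ p₁] at hℓ
    by_cases h4u' : p₄ = u'
    · subst h4u'
      rw [pathKernel_self] at hℓ
      have h := h2A ⟨v, huv, hv⟩ ⟨v', hu'v', hv'⟩
      exact (not_lt.2 (mul_le_one' h h)) hℓ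
    · have h := h3A p₁ p₄ u' (Or.inl rfl) ⟨v, huv, hv⟩ h14 huu' h4u'
      rw [mul_comm] at hℓ
      exact (not_lt.2 h) hℓ
  -- `u' = p₄` (`u ≠ p₁`): `ℓ₁ = Z(p₁,u)`, `ℓ₂ = Z(p₄,p₁) Z(p₄,u) ≤ ℓ₁` by `h3A`
  by_cases h4u' : p₄ = u'
  · subst h4u'
    exfalso
    rw [pathKernel_self, mul_one, pathKernel_comm GA x p₁ p₄] at hℓ
    have h := h3A p₄ p₁ u (Or.inr rfl) ⟨v', hu'v', hv'⟩ (Ne.symm h14) (Ne.symm huu') h1u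
    exact (not_lt.2 h) hℓ
  -- `u' = p₁` (`u ≠ p₁`, `u' ≠ p₄`)
  by_cases h1u' : p₁ = u'
  · subst h1u'
    by_cases h4u : p₄ = u
    · -- both side paths are trivial
      subst h4u
      refine ⟨SimpleGraph.Walk.nil, SimpleGraph.Walk.nil, SimpleGraph.Walk.IsPath.nil,
        SimpleGraph.Walk.IsPath.nil, ?_⟩
      rw [SimpleGraph.Walk.support_nil, SimpleGraph.Walk.support_nil, List.singleton_disjoint,
        List.mem_singleton]
      exact h14
    · -- `ℓ₂ = Z(u,p₄)`, `ℓ₁ = Z(u,p₁) Z(p₁,p₄)`: some path `u → p₄` avoids `p₁`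
      rw [pathKernel_self, one_mul, pathKernel_comm GA x p₁ u, pathKernel_comm GA x p₄ p₁,
        pathKernel_comm GA x p₄ u] at hℓ
      by_cases hall : ∀ P' : GA.Path u p₄, p₁ ∈ P'.1.support
      · exact ((not_lt.2 (pathKernel_le_mul_of_forall_mem_support GA x hx hall)) hℓ).elim
      · push Not at hall
        obtain ⟨P', hP'⟩ := hall
        refine ⟨SimpleGraph.Walk.nil, P'.1, SimpleGraph.Walk.IsPath.nil, P'.2, ?_⟩
        rw [SimpleGraph.Walk.support_nil, List.singleton_disjoint]
        exact hP'
  -- `u = p₄` (`u ≠ p₁`, `u' ∉ {p₁, p₄}`): `ℓ₂ = Z(p₁,u')`, `ℓ₁ = Z(p₁,p₄) Z(p₄,u')`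
  by_cases h4u : p₄ = u
  · subst h4u
    rw [pathKernel_self, mul_one] at hℓ
    by_cases hall : ∀ P : GA.Path p₁ u', p₄ ∈ P.1.support
    · exact ((not_lt.2 (pathKernel_le_mul_of_forall_mem_support GA x hx hall)) hℓ).elim
    · push Not at hall
      obtain ⟨P, hP⟩ := hall
      refine ⟨P.1, SimpleGraph.Walk.nil, P.2, SimpleGraph.Walk.IsPath.nil, ?_⟩
      rw [SimpleGraph.Walk.support_nil, List.disjoint_singleton]
      exact hP
  -- generic case: `p₁, u, u', p₄` pairwise distinct, and `(p₁, u, u', p₄)` is not interlaced in `G_A`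
  by_cases hint : Interlaced GA p₁ u u' p₄
  · have h := tpA p₁ u u' p₄ h1u h1u' h14 huu' (Ne.symm h4u) (Ne.symm h4u') hint
    rw [pathKernel_comm GA x p₄ u', pathKernel_comm GA x p₄ u] at hℓ
    exact ((not_lt.2 h) hℓ).elim
  · unfold Interlaced at hint
    push Not at hint
    obtain ⟨P, P', hPP'⟩ := hint
    exact ⟨P.1, P'.1, P.2, P'.2, fun _ hw hw' => hPP' _ hw hw'⟩

/-! ## Side `B`: the targets -/

/-- **Side `B` of the cut.** In the situation of `cutPair_false_of_glue` (two cut darts `u → v`, `u' → v'`,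
vertex-disjoint self-avoiding side-`A` paths `P : p₁ → u'`, `P' : u → p₄`, interlacing in `H`), and for a
graph `G_B ≤ H` with all edges ending outside `A` satisfying TP₂ for its interlaced pairwise distinct
quadruples (`tpB`), the three-point inequality at `c ∈ {p₂, p₃}` whenever `c` carries a dart of `H` into
`A` (`h3B`) and `Z(p₂,p₃) ≤ 1` when both do (`h2B`):
`μ₁ = Z(v,p₂) Z(v',p₃) ≤ Z(v,p₃) Z(v',p₂) = μ₂`. Cases: `p₂ = p₃` or `v = v'` (equality); `v = p₃` or
`v' = p₂` (`h3B`, `h2B`); otherwise `μ₂ < μ₁` would produce vertex-disjoint self-avoiding paths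
`p₂ → v`, `v' → p₃` of `G_B` (a trivial path and a path avoiding it by cutting at a forced vertex, or
`¬ Interlaced G_B v p₃ p₂ v'` by `tpB`), contradicting `cutPair_false_of_glue`. [folklore] -/
private theorem sideB_le {H GA GB : SimpleGraph V} {x : ℝ} (hx : 0 ≤ x) {A : Set V}
    {p₁ p₂ p₃ p₄ u v u' v' : V} (hAle : GA ≤ H) (hBle : GB ≤ H)
    (hA' : ∀ a b, GA.Adj a b → b ∈ A) (hB' : ∀ a b, GB.Adj a b → b ∉ A)
    (hI : Interlaced H p₁ p₂ p₃ p₄) (h₁ : p₁ ∈ A) (h₂ : p₂ ∉ A)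
    (huv : H.Adj u v) (hu : u ∈ A) (hu'v' : H.Adj u' v') (hu' : u' ∈ A) (hv' : v' ∉ A)
    (tpB : ∀ q₁ q₂ q₃ q₄ : V, q₁ ≠ q₂ → q₁ ≠ q₃ → q₁ ≠ q₄ → q₂ ≠ q₃ → q₂ ≠ q₄ → q₃ ≠ q₄ →
      Interlaced GB q₁ q₂ q₃ q₄ →
        pathKernel GB x q₁ q₃ * pathKernel GB x q₂ q₄ ≤ pathKernel GB x q₁ q₂ * pathKernel GB x q₃ q₄)
    (h3B : ∀ c p q : V, (c = p₂ ∨ c = p₃) → (∃ w, H.Adj c w ∧ w ∈ A) → c ≠ p → c ≠ q → p ≠ q →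
      pathKernel GB x c p * pathKernel GB x c q ≤ pathKernel GB x p q)
    (h2B : (∃ w, H.Adj p₂ w ∧ w ∈ A) → (∃ w, H.Adj p₃ w ∧ w ∈ A) → pathKernel GB x p₂ p₃ ≤ 1)
    (P : GA.Walk p₁ u') (P' : GA.Walk u p₄) (hP : P.IsPath) (hP' : P'.IsPath)
    (hPP' : List.Disjoint P.support P'.support) :
    pathKernel GB x v p₂ * pathKernel GB x v' p₃ ≤ pathKernel GB x v p₃ * pathKernel GB x v' p₂ := by
  classical
  have glue : ∀ (Q : GB.Walk p₂ v) (Q' : GB.Walk v' p₃), Q.IsPath → Q'.IsPath →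
      List.Disjoint Q.support Q'.support → False := fun Q Q' hQ hQ' hQQ' =>
    cutPair_false_of_glue hAle hBle hA' hB' hI huv hu'v' h₁ hu h₂ hv' P P' hP hP' hPP' Q Q' hQ hQ' hQQ'
  -- `p₂ = p₃` or `v = v'`: equality
  by_cases h23 : p₂ = p₃
  · subst h23
    exact le_rfl
  by_cases hvv' : v = v'
  · subst hvv'
    exact (mul_comm _ _).le
  -- `v = p₃`: `μ₂ = Z(v',p₂)`, `μ₁ = Z(p₃,p₂) Z(p₃,v') ≤ μ₂` by `h3B` (`h2B` if moreover `v' = p₂`)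
  by_cases h3v : p₃ = v
  · subst h3v
    rw [pathKernel_self, one_mul]
    by_cases h2v' : p₂ = v'
    · subst h2v'
      rw [pathKernel_self, pathKernel_comm GB x p₃ p₂]
      have h := h2B ⟨u', hu'v'.symm, hu'⟩ ⟨u, huv.symm, hu⟩
      exact mul_le_one' h h
    · rw [pathKernel_comm GB x v' p₃, pathKernel_comm GB x v' p₂]
      exact h3B p₃ p₂ v' (Or.inr rfl) ⟨u, huv.symm, hu⟩ (Ne.symm h23) hvv' h2v'
  -- `v' = p₂` (`v ≠ p₃`): `μ₂ = Z(v,p₃)`, `μ₁ = Z(p₂,v) Z(p₂,p₃) ≤ μ₂` by `h3B`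
  by_cases h2v' : p₂ = v'
  · subst h2v'
    rw [pathKernel_self, mul_one, pathKernel_comm GB x v p₂]
    exact h3B p₂ v p₃ (Or.inl rfl) ⟨u', hu'v'.symm, hu'⟩ (Ne.symm hvv') h23 (Ne.symm h3v)
  -- otherwise `μ₂ < μ₁` produces vertex-disjoint side-`B` paths `p₂ → v`, `v' → p₃`: absurd
  by_contra hlt
  rw [not_le] at hlt
  -- `v = p₂`
  by_cases h2v : p₂ = v
  · subst h2v
    by_cases h3v' : p₃ = v'
    · subst h3v'
      refine glue SimpleGraph.Walk.nil SimpleGraph.Walk.nil SimpleGraph.Walk.IsPath.nil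
        SimpleGraph.Walk.IsPath.nil ?_
      rw [SimpleGraph.Walk.support_nil, SimpleGraph.Walk.support_nil, List.singleton_disjoint,
        List.mem_singleton]
      exact h23
    · -- `μ₁ = Z(v',p₃)`, `μ₂ = Z(v',p₂) Z(p₂,p₃)`: some path `v' → p₃` avoids `p₂`
      rw [pathKernel_self, one_mul, mul_comm] at hlt
      by_cases hall : ∀ Q' : GB.Path v' p₃, p₂ ∈ Q'.1.support
      · exact (not_lt.2 (pathKernel_le_mul_of_forall_mem_support GB x hx hall)) hlt
      · push Not at hall
        obtain ⟨Q', hQ'⟩ := hall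
        refine glue SimpleGraph.Walk.nil Q'.1 SimpleGraph.Walk.IsPath.nil Q'.2 ?_
        rw [SimpleGraph.Walk.support_nil, List.singleton_disjoint]
        exact hQ'
  -- `v' = p₃` (`v ≠ p₂`): `μ₁ = Z(p₂,v)`, `μ₂ = Z(p₂,p₃) Z(p₃,v)`: some path `p₂ → v` avoids `p₃`
  by_cases h3v' : p₃ = v'
  · subst h3v'
    rw [pathKernel_self, mul_one, pathKernel_comm GB x v p₃, pathKernel_comm GB x p₃ p₂,
      pathKernel_comm GB x v p₂, mul_comm] at hlt
    by_cases hall : ∀ Q : GB.Path p₂ v, p₃ ∈ Q.1.support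
    · exact (not_lt.2 (pathKernel_le_mul_of_forall_mem_support GB x hx hall)) hlt
    · push Not at hall
      obtain ⟨Q, hQ⟩ := hall
      refine glue Q.1 SimpleGraph.Walk.nil Q.2 SimpleGraph.Walk.IsPath.nil ?_
      rw [SimpleGraph.Walk.support_nil, List.disjoint_singleton]
      exact hQ
  -- generic case: `v, v', p₂, p₃` pairwise distinct, and `(v, p₃, p₂, v')` is not interlaced in `G_B`
  by_cases hint : Interlaced GB v p₃ p₂ v'
  · have h := tpB v p₃ p₂ v' (Ne.symm h3v) (Ne.symm h2v) hvv' (Ne.symm h23) h3v' h2v' hint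
    rw [pathKernel_comm GB x v' p₂, pathKernel_comm GB x v' p₃] at hlt
    exact (not_lt.2 h) hlt
  · unfold Interlaced at hint
    push Not at hint
    obtain ⟨Q, Q', hQQ'⟩ := hint
    exact glue Q.1.reverse Q'.1.reverse Q.2.reverse Q'.2.reverse fun w hw hw' =>
      hQQ' w (by simpa using hw) (by simpa using hw')

/-! ## The core implication and the stub -/

/-- **The core implication `ℓ₁ < ℓ₂ → μ₁ ≤ μ₂`** for two cut darts `u → v`, `u' → v'` of a vertex cut
`(A, Aᶜ)` separating the sources `p₁` (`∈ A`) from the targets `p₂` (`∉ A`) of an interlaced quadruple,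
with `G_A, G_B ≤ H` the two sides (edges ending inside / outside `A`) and the hypotheses of
`sideA_paths` / `sideB_le`: `ℓ₁ < ℓ₂` forces `u ≠ u'`, `p₁ ≠ p₄`, hence vertex-disjoint side-`A` paths
(`sideA_paths`), hence `μ₁ ≤ μ₂` (`sideB_le`). [folklore] -/
private theorem sideB_le_of_sideA_lt {H GA GB : SimpleGraph V} {x : ℝ} (hx : 0 ≤ x) {A : Set V}
    {p₁ p₂ p₃ p₄ : V} (u v u' v' : V) (hAle : GA ≤ H) (hBle : GB ≤ H)
    (hA' : ∀ a b, GA.Adj a b → b ∈ A) (hB' : ∀ a b, GB.Adj a b → b ∉ A)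
    (hI : Interlaced H p₁ p₂ p₃ p₄) (h₁ : p₁ ∈ A) (h₂ : p₂ ∉ A)
    (huv : H.Adj u v) (hu : u ∈ A) (hv : v ∉ A) (hu'v' : H.Adj u' v') (hu' : u' ∈ A) (hv' : v' ∉ A)
    (tpA : ∀ q₁ q₂ q₃ q₄ : V, q₁ ≠ q₂ → q₁ ≠ q₃ → q₁ ≠ q₄ → q₂ ≠ q₃ → q₂ ≠ q₄ → q₃ ≠ q₄ →
      Interlaced GA q₁ q₂ q₃ q₄ →
        pathKernel GA x q₁ q₃ * pathKernel GA x q₂ q₄ ≤ pathKernel GA x q₁ q₂ * pathKernel GA x q₃ q₄)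
    (tpB : ∀ q₁ q₂ q₃ q₄ : V, q₁ ≠ q₂ → q₁ ≠ q₃ → q₁ ≠ q₄ → q₂ ≠ q₃ → q₂ ≠ q₄ → q₃ ≠ q₄ →
      Interlaced GB q₁ q₂ q₃ q₄ →
        pathKernel GB x q₁ q₃ * pathKernel GB x q₂ q₄ ≤ pathKernel GB x q₁ q₂ * pathKernel GB x q₃ q₄)
    (h3A : ∀ c p q : V, (c = p₁ ∨ c = p₄) → (∃ w, H.Adj c w ∧ w ∉ A) → c ≠ p → c ≠ q → p ≠ q →
      pathKernel GA x c p * pathKernel GA x c q ≤ pathKernel GA x p q)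
    (h3B : ∀ c p q : V, (c = p₂ ∨ c = p₃) → (∃ w, H.Adj c w ∧ w ∈ A) → c ≠ p → c ≠ q → p ≠ q →
      pathKernel GB x c p * pathKernel GB x c q ≤ pathKernel GB x p q)
    (h2A : (∃ w, H.Adj p₁ w ∧ w ∉ A) → (∃ w, H.Adj p₄ w ∧ w ∉ A) → pathKernel GA x p₁ p₄ ≤ 1)
    (h2B : (∃ w, H.Adj p₂ w ∧ w ∈ A) → (∃ w, H.Adj p₃ w ∧ w ∈ A) → pathKernel GB x p₂ p₃ ≤ 1)
    (hℓ : pathKernel GA x p₁ u * pathKernel GA x p₄ u' <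
      pathKernel GA x p₁ u' * pathKernel GA x p₄ u) :
    pathKernel GB x v p₂ * pathKernel GB x v' p₃ ≤ pathKernel GB x v p₃ * pathKernel GB x v' p₂ := by
  have huu' : u ≠ u' := by
    rintro rfl
    exact lt_irrefl _ hℓ
  have h14 : p₁ ≠ p₄ := by
    rintro rfl
    rw [mul_comm] at hℓ
    exact lt_irrefl _ hℓ
  obtain ⟨P, P', hP, hP', hPP'⟩ := sideA_paths hx h14 huu' huv hv hu'v' hv' tpA h3A h2A hℓ
  exact sideB_le hx hAle hBle hA' hB' hI h₁ h₂ huv hu hu'v' hu' hv' tpB h3B h2B P P' hP hP' hPP'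

/-- **The cut-pair sign lemma** (registered stub `cutPairSign_core` of crux `BoundaryTP2`, toolkit of
the line `renewal-cauchy-binet`). Let `(A, Aᶜ)` be a vertex cut of `H` with `p₁, p₄ ∈ A`, `p₂, p₃ ∉ A`,
`p₁ p₂ p₃ p₄` interlaced in `H`, and let `u → v`, `u' → v'` be two darts of `H` leaving `A`. With
`G_A = SimpleGraph.fromRel (H.Adj a b ∧ a ∈ A ∧ b ∈ A)`, `G_B = SimpleGraph.fromRel (H.Adj a b ∧ a ∉ A ∧ b ∉ A)`,
`Z = pathKernel · x` (`0 ≤ x`), `ℓ₁ = Z_A(p₁,u) Z_A(p₄,u')`, `ℓ₂ = Z_A(p₁,u') Z_A(p₄,u)`,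
`μ₁ = Z_B(v,p₂) Z_B(v',p₃)`, `μ₂ = Z_B(v,p₃) Z_B(v',p₂)`, and granted TP₂ for the interlaced pairwise
distinct quadruples of `G_A` and `G_B` (`tpA`, `tpB`), the three-point inequalities at the marked
vertices carrying a cut dart (`h3A`, `h3B`) and the two-point bounds (`h2A`, `h2B`):
`ℓ₁ μ₂ + ℓ₂ μ₁ ≤ ℓ₁ μ₁ + ℓ₂ μ₂`. Indeed `ℓ₁ < ℓ₂ → μ₁ ≤ μ₂` (`sideB_le_of_sideA_lt`), the same for the
swapped darts, and the rearrangement inequality. (The hypotheses `hfin`, `h₄`, `h₃`, `hne` are part of the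
registered signature but logically redundant; `0 ≤ x` is needed: at `x = -1` the path `p₄ p₁ u`, darts
`u → p₂`, `p₁ → p₃` and no further edges give `ℓ₁ = μ₂ = 0`, `ℓ₂ = μ₁ = 1`.) [folklore] -/
theorem cutPairSign_core (H : SimpleGraph V) (x : ℝ) (hx : 0 ≤ x) (hfin : H.support.Finite)
    (A : Set V) (p₁ p₂ p₃ p₄ u v u' v' : V)
    (h₁ : p₁ ∈ A) (h₄ : p₄ ∈ A) (h₂ : p₂ ∉ A) (h₃ : p₃ ∉ A) (hI : Interlaced H p₁ p₂ p₃ p₄)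
    (huv : H.Adj u v) (hu : u ∈ A) (hv : v ∉ A) (hu'v' : H.Adj u' v') (hu' : u' ∈ A) (hv' : v' ∉ A)
    (hne : u ≠ u' ∨ v ≠ v')
    (tpA : ∀ q₁ q₂ q₃ q₄ : V, q₁ ≠ q₂ → q₁ ≠ q₃ → q₁ ≠ q₄ → q₂ ≠ q₃ → q₂ ≠ q₄ → q₃ ≠ q₄ →
      Interlaced (SimpleGraph.fromRel fun a b => H.Adj a b ∧ a ∈ A ∧ b ∈ A) q₁ q₂ q₃ q₄ →
        pathKernel (SimpleGraph.fromRel fun a b => H.Adj a b ∧ a ∈ A ∧ b ∈ A) x q₁ q₃ *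
            pathKernel (SimpleGraph.fromRel fun a b => H.Adj a b ∧ a ∈ A ∧ b ∈ A) x q₂ q₄ ≤
          pathKernel (SimpleGraph.fromRel fun a b => H.Adj a b ∧ a ∈ A ∧ b ∈ A) x q₁ q₂ *
            pathKernel (SimpleGraph.fromRel fun a b => H.Adj a b ∧ a ∈ A ∧ b ∈ A) x q₃ q₄)
    (tpB : ∀ q₁ q₂ q₃ q₄ : V, q₁ ≠ q₂ → q₁ ≠ q₃ → q₁ ≠ q₄ → q₂ ≠ q₃ → q₂ ≠ q₄ → q₃ ≠ q₄ →
      Interlaced (SimpleGraph.fromRel fun a b => H.Adj a b ∧ a ∉ A ∧ b ∉ A) q₁ q₂ q₃ q₄ →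
        pathKernel (SimpleGraph.fromRel fun a b => H.Adj a b ∧ a ∉ A ∧ b ∉ A) x q₁ q₃ *
            pathKernel (SimpleGraph.fromRel fun a b => H.Adj a b ∧ a ∉ A ∧ b ∉ A) x q₂ q₄ ≤
          pathKernel (SimpleGraph.fromRel fun a b => H.Adj a b ∧ a ∉ A ∧ b ∉ A) x q₁ q₂ *
            pathKernel (SimpleGraph.fromRel fun a b => H.Adj a b ∧ a ∉ A ∧ b ∉ A) x q₃ q₄)
    (h3A : ∀ c p q : V, (c = p₁ ∨ c = p₄) → (∃ w, H.Adj c w ∧ w ∉ A) → c ≠ p → c ≠ q → p ≠ q →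
      pathKernel (SimpleGraph.fromRel fun a b => H.Adj a b ∧ a ∈ A ∧ b ∈ A) x c p *
          pathKernel (SimpleGraph.fromRel fun a b => H.Adj a b ∧ a ∈ A ∧ b ∈ A) x c q ≤
        pathKernel (SimpleGraph.fromRel fun a b => H.Adj a b ∧ a ∈ A ∧ b ∈ A) x p q)
    (h3B : ∀ c p q : V, (c = p₂ ∨ c = p₃) → (∃ w, H.Adj c w ∧ w ∈ A) → c ≠ p → c ≠ q → p ≠ q →
      pathKernel (SimpleGraph.fromRel fun a b => H.Adj a b ∧ a ∉ A ∧ b ∉ A) x c p *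
          pathKernel (SimpleGraph.fromRel fun a b => H.Adj a b ∧ a ∉ A ∧ b ∉ A) x c q ≤
        pathKernel (SimpleGraph.fromRel fun a b => H.Adj a b ∧ a ∉ A ∧ b ∉ A) x p q)
    (h2A : (∃ w, H.Adj p₁ w ∧ w ∉ A) → (∃ w, H.Adj p₄ w ∧ w ∉ A) →
      pathKernel (SimpleGraph.fromRel fun a b => H.Adj a b ∧ a ∈ A ∧ b ∈ A) x p₁ p₄ ≤ 1)
    (h2B : (∃ w, H.Adj p₂ w ∧ w ∈ A) → (∃ w, H.Adj p₃ w ∧ w ∈ A) →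
      pathKernel (SimpleGraph.fromRel fun a b => H.Adj a b ∧ a ∉ A ∧ b ∉ A) x p₂ p₃ ≤ 1) :
    pathKernel (SimpleGraph.fromRel fun a b => H.Adj a b ∧ a ∈ A ∧ b ∈ A) x p₁ u *
          pathKernel (SimpleGraph.fromRel fun a b => H.Adj a b ∧ a ∈ A ∧ b ∈ A) x p₄ u' *
        (pathKernel (SimpleGraph.fromRel fun a b => H.Adj a b ∧ a ∉ A ∧ b ∉ A) x v p₃ *
          pathKernel (SimpleGraph.fromRel fun a b => H.Adj a b ∧ a ∉ A ∧ b ∉ A) x v' p₂) +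
      pathKernel (SimpleGraph.fromRel fun a b => H.Adj a b ∧ a ∈ A ∧ b ∈ A) x p₁ u' *
          pathKernel (SimpleGraph.fromRel fun a b => H.Adj a b ∧ a ∈ A ∧ b ∈ A) x p₄ u *
        (pathKernel (SimpleGraph.fromRel fun a b => H.Adj a b ∧ a ∉ A ∧ b ∉ A) x v p₂ *
          pathKernel (SimpleGraph.fromRel fun a b => H.Adj a b ∧ a ∉ A ∧ b ∉ A) x v' p₃) ≤
    pathKernel (SimpleGraph.fromRel fun a b => H.Adj a b ∧ a ∈ A ∧ b ∈ A) x p₁ u *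
          pathKernel (SimpleGraph.fromRel fun a b => H.Adj a b ∧ a ∈ A ∧ b ∈ A) x p₄ u' *
        (pathKernel (SimpleGraph.fromRel fun a b => H.Adj a b ∧ a ∉ A ∧ b ∉ A) x v p₂ *
          pathKernel (SimpleGraph.fromRel fun a b => H.Adj a b ∧ a ∉ A ∧ b ∉ A) x v' p₃) +
      pathKernel (SimpleGraph.fromRel fun a b => H.Adj a b ∧ a ∈ A ∧ b ∈ A) x p₁ u' *
          pathKernel (SimpleGraph.fromRel fun a b => H.Adj a b ∧ a ∈ A ∧ b ∈ A) x p₄ u *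
        (pathKernel (SimpleGraph.fromRel fun a b => H.Adj a b ∧ a ∉ A ∧ b ∉ A) x v p₃ *
          pathKernel (SimpleGraph.fromRel fun a b => H.Adj a b ∧ a ∉ A ∧ b ∉ A) x v' p₂) := by
  -- `hfin`, `h₄`, `h₃`, `hne` are part of the registered signature but logically redundant here
  have _ := hfin
  have _ := h₄
  have _ := h₃
  have _ := hne
  set GA := SimpleGraph.fromRel fun a b => H.Adj a b ∧ a ∈ A ∧ b ∈ A with hGA
  set GB := SimpleGraph.fromRel fun a b => H.Adj a b ∧ a ∉ A ∧ b ∉ A with hGB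
  -- the two sides are subgraphs of `H` with all edges ending inside, resp. outside, `A`
  have hAle : GA ≤ H := fun a b h => by
    rw [hGA, partGraph_adj_iff] at h
    exact h.1
  have hBle : GB ≤ H := fun a b h => by
    rw [hGB, partGraph_adj_iff] at h
    exact h.1
  have hA' : ∀ a b, GA.Adj a b → b ∈ A := fun a b h => by
    rw [hGA, partGraph_adj_iff] at h
    exact h.2.2
  have hB' : ∀ a b, GB.Adj a b → b ∉ A := fun a b h => by
    rw [hGB, partGraph_adj_iff] at h
    exact h.2.2
  rcases lt_trichotomy (pathKernel GA x p₁ u * pathKernel GA x p₄ u')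
    (pathKernel GA x p₁ u' * pathKernel GA x p₄ u) with hlt | heq | hgt
  · -- `ℓ₁ < ℓ₂`, hence `μ₁ ≤ μ₂`
    exact rearrangement hlt.le (sideB_le_of_sideA_lt hx u v u' v' hAle hBle hA' hB' hI h₁ h₂ huv hu
      hv hu'v' hu' hv' tpA tpB h3A h3B h2A h2B hlt)
  · -- `ℓ₁ = ℓ₂`
    rw [heq, add_comm]
  · -- `ℓ₂ < ℓ₁`, hence `μ₂ ≤ μ₁` (the darts swapped)
    have hμ := sideB_le_of_sideA_lt hx u' v' u v hAle hBle hA' hB' hI h₁ h₂ hu'v' hu' hv' huv hu hv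
      tpA tpB h3A h3B h2A h2B hgt
    rw [mul_comm (pathKernel GB x v' p₂), mul_comm (pathKernel GB x v' p₃)] at hμ
    exact (add_comm _ _).trans_le ((rearrangement hgt.le hμ).trans_eq (add_comm _ _))

end Summit.CriticalPhenomena.SAWScalingLimit.Theorems.BoundaryTP2

end
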